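import Mathlib.RingTheory.Polynomial.RationalRoot
import Summits.CriticalPhenomena.Ising3D.IsingColumnFaceL11CensusGapsAlg

/-!
# The catalogue census of §7.3 as kernel facts, IX: the RATIONAL values of the algebraic family `ALG` on
the certified `Δε` segment (cell `pub-ising3x`, seat recog-1; paper §7.3)

HONEST FRAMING: lottery ticket; floor = tightest certified 3D Ising CFT bounds; no exact-solution
claim without a proof. Island framing: certified exclusion region at stated derivative order and
assumptions; not a determination of the 3D Ising critical exponents beyond that.

The frozen family `ALG` of FAMILIES-v1 (`algFamily d H`, `(d, H) ∈ algTable`: integer polynomials of degree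
`d ≤ 6` and height `≤ H_d = 1024 / 64 / 12 / 6 / 3 / 2`) is counted in §7.3 by DESCRIPTIONS
(`IsingColumnFaceL11CensusSegmentAlg*.lean`: 17 867 / 24 584 / 20 260 per closed sub-window). This file pins the
RATIONAL part of its VALUE set on the closed segment `[81/64, 2855/2048]`, exactly:
* `ratRoot_num_den_le` — the rational-root theorem on the table's coefficient lists: a non-zero rational root
  `r` of a non-zero integer polynomial all of whose coefficients are `≤ H` in absolute value has
  `|num r| ≤ H` and `den r ≤ H` (Mathlib's `num_dvd_of_is_root` / `den_dvd_of_is_root` for the fraction field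
  `ℚ` of `ℤ`, transported to `Rat.num` / `Rat.den` by `Rat.num_dvd` / `Rat.den_dvd`; a zero constant term is
  deflated by `Polynomial.X_mul_divX_add`, by induction on the degree);
* `alg_rational_values_eq` — the rational members of `ALG` in the segment are EXACTLY the fractions `p/q`
  (lowest terms) of the segment with `p ≤ 1024` and `q ≤ 1024`: each is a degree-1 description `qX − p` (the
  landed `ratCast_mem_algFamily_one`), and no higher rung adds a rational value (its heights are `≤ 64`);
* `ratSeg1024` / `ratSeg1024_ok` — the list of those fractions, denominator by denominator (one light kernel
  evaluation: 23 213 entries, no duplicates by construction), `mem_ratSeg1024_iff`;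
* **`alg_rational_values_segment_ncard`** — `ALG` has exactly **23 213 rational values** on the closed segment
  (VALUES, i.e. reduced fractions in `[81/64, 2855/2048]`; each is also one degree-1 description, so the
  degree-1 description counts 6 657 / 9 090 / 7 468 of Appendix B.1.12 are value counts, `13/10` and `27/20`
  lying in two sub-windows each: 6 657 + 9 090 + 7 468 − 2 = 23 213).
A statement about the frozen catalogue, NOT about `Δε`; pure algebra over landed definitions; no
certificate, no datum, no σ–ε axiom, no constant; nothing is recognised (§1.6); no P(M·) relevance. The
irrational values of the table (35 930 by the exact-twin census of recog-1 gen 54, two implementations) are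
NOT counted by the kernel here.
lottery ticket; floor = tightest certified 3D Ising CFT bounds; no exact-solution claim without a proof.
-/

namespace Summit.CriticalPhenomena.Ising3D
namespace ColumnFaceL11
open Set Polynomial Literature.MathematicalPhysics.QuantumFieldTheory.ConformalBootstrap3D

/-! ### The rational-root bound on heights -/

/-- **Rational-root theorem, height form.** A non-zero rational root `r` of a non-zero `p ∈ ℤ[X]` with all
coefficients bounded by `H` in absolute value has `|num r| ≤ H` and `den r ≤ H`. [folklore] -/
theorem ratRoot_num_den_le (H : ℕ) : ∀ (n : ℕ) (p : ℤ[X]), p.natDegree ≤ n → p ≠ 0 → (∀ i, |p.coeff i| ≤ H) →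
    ∀ {r : ℚ}, r ≠ 0 → aeval r p = 0 → r.num.natAbs ≤ H ∧ r.den ≤ H := by
  intro n
  induction n with
  | zero =>
      intro p hdeg hp0 _ r _ hr
      -- degree 0, non-zero: a non-zero constant has no root
      exfalso
      have hp : p = C (p.coeff 0) := eq_C_of_natDegree_le_zero hdeg
      rw [hp, aeval_C, algebraMap_int_eq, eq_intCast, Int.cast_eq_zero] at hr
      exact hp0 (by rw [hp, hr, C_0])
  | succ n ih =>
      intro p hdeg hp0 hH r hr0 hr
      by_cases h0 : p.coeff 0 = 0
      · -- deflate: p = X · divX p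
        have hsplit : X * divX p = p := by have := X_mul_divX_add p; rwa [h0, C_0, add_zero] at this
        have hq0 : divX p ≠ 0 := by intro hq; rw [divX_eq_zero_iff, h0, C_0] at hq; exact hp0 hq
        have hqdeg : (divX p).natDegree ≤ n := by rw [natDegree_divX_eq_natDegree_tsub_one]; omega
        have hqH : ∀ i, |(divX p).coeff i| ≤ H := fun i => by rw [coeff_divX]; exact hH (i + 1)
        have hqr : aeval r (divX p) = 0 := by
          rw [← hsplit, map_mul, aeval_X] at hr; exact (mul_eq_zero.mp hr).resolve_left hr0
        exact ih (divX p) hqdeg hq0 hqH hr0 hqr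
      · -- constant term non-zero: Mathlib's rational-root theorem over the fraction field ℚ of ℤ
        have hnum : IsFractionRing.num ℤ r ∣ p.coeff 0 := num_dvd_of_is_root hr
        have hden : ((IsFractionRing.den ℤ r : ℤ)) ∣ p.leadingCoeff := den_dvd_of_is_root hr
        have hrep : ((IsFractionRing.num ℤ r : ℤ) : ℚ) / ((IsFractionRing.den ℤ r : ℤ) : ℚ) = r := by
          have := IsFractionRing.mk'_num_den' ℤ r
          simpa using this
        have hden0 : ((IsFractionRing.den ℤ r : ℤ)) ≠ 0 :=
          mem_nonZeroDivisors_iff_ne_zero.mp (IsFractionRing.den ℤ r).2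
        have hnum0 : IsFractionRing.num ℤ r ≠ 0 := by intro h; apply hr0; rw [← hrep, h]; simp
        -- transport to `Rat.num` / `Rat.den`
        have h1 : r.num ∣ IsFractionRing.num ℤ r := by
          have := Rat.num_dvd (IsFractionRing.num ℤ r) hden0
          rwa [← Rat.intCast_div_eq_divInt, hrep] at this
        have h2 : (r.den : ℤ) ∣ (IsFractionRing.den ℤ r : ℤ) := by
          have := Rat.den_dvd (IsFractionRing.num ℤ r) (IsFractionRing.den ℤ r : ℤ)
          rwa [← Rat.intCast_div_eq_divInt, hrep] at this
        have hlc0 : p.leadingCoeff ≠ 0 := leadingCoeff_ne_zero.mpr hp0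
        constructor
        · have a1 : r.num.natAbs ≤ (IsFractionRing.num ℤ r).natAbs :=
            Nat.le_of_dvd (Int.natAbs_pos.mpr hnum0) (Int.natAbs_dvd_natAbs.mpr h1)
          have a2 : (IsFractionRing.num ℤ r).natAbs ≤ (p.coeff 0).natAbs :=
            Nat.le_of_dvd (Int.natAbs_pos.mpr h0) (Int.natAbs_dvd_natAbs.mpr hnum)
          have a3 : ((p.coeff 0).natAbs : ℤ) ≤ H := by rw [Int.natCast_natAbs]; exact hH 0
          omega
        · have b1 : r.den ≤ (IsFractionRing.den ℤ r : ℤ).natAbs := by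
            have := Nat.le_of_dvd (Int.natAbs_pos.mpr hden0) (Int.natAbs_dvd_natAbs.mpr h2)
            simpa using this
          have b2 : (IsFractionRing.den ℤ r : ℤ).natAbs ≤ p.leadingCoeff.natAbs :=
            Nat.le_of_dvd (Int.natAbs_pos.mpr hlc0) (Int.natAbs_dvd_natAbs.mpr hden)
          have b3 : (p.leadingCoeff.natAbs : ℤ) ≤ H := by
            rw [Int.natCast_natAbs]; exact hH p.natDegree
          omega

/-! ### From a family member to a polynomial -/

/-- The polynomial `Σ cᵢ Xⁱ` of a coefficient vector. [folklore] -/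
noncomputable def polyOfFin {d : ℕ} (c : Fin (d + 1) → ℤ) : ℤ[X] := ∑ i : Fin (d + 1), monomial (i : ℕ) (c i)

/-- Its coefficients: `cⱼ` for `j ≤ d`, `0` beyond. [folklore] -/
theorem coeff_polyOfFin {d : ℕ} (c : Fin (d + 1) → ℤ) (j : ℕ) :
    (polyOfFin c).coeff j = if h : j < d + 1 then c ⟨j, h⟩ else 0 := by
  unfold polyOfFin
  rw [finsetSum_coeff]
  simp only [coeff_monomial]
  split_ifs with h
  · rw [Finset.sum_eq_single ⟨j, h⟩]
    · simp
    · intro b _ hb; rw [if_neg]; intro hbj; apply hb; ext; exact hbj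
    · intro habs; exact absurd (Finset.mem_univ _) habs
  · exact Finset.sum_eq_zero fun i _ => by rw [if_neg]; intro hij; apply h; rw [← hij]; exact i.2

/-- A rational member of `algFamily d H` has numerator and denominator at most `H`. [folklore] -/
theorem num_den_le_of_ratCast_mem_algFamily {d H : ℕ} {r : ℚ} (hr0 : r ≠ 0)
    (h : (r : ℝ) ∈ algFamily d H) : r.num.natAbs ≤ H ∧ r.den ≤ H := by
  obtain ⟨c, hlead, hH, hroot⟩ := h
  set p := polyOfFin c with hp
  have hp0 : p ≠ 0 := by
    intro h0
    have := congrArg (fun q => q.coeff d) h0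
    simp only [hp, coeff_polyOfFin, coeff_zero, lt_add_iff_pos_right, zero_lt_one, dite_true] at this
    exact hlead (by simpa [Fin.last] using this)
  have hcoef : ∀ i, |p.coeff i| ≤ H := fun i => by
    rw [hp, coeff_polyOfFin]; split_ifs; exacts [hH _, by simp]
  have haeval : aeval r p = 0 := by
    -- the real equation `Σ cᵢ rⁱ = 0`, pulled back along the injective cast `ℚ → ℝ`
    have hR : aeval ((r : ℚ) : ℝ) p = 0 := by
      rw [hp, polyOfFin, map_sum]
      simp only [aeval_monomial, algebraMap_int_eq, eq_intCast]
      exact hroot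
    have hcomm : (algebraMap ℚ ℝ) (aeval r p) = aeval ((r : ℚ) : ℝ) p := by
      rw [← aeval_algebraMap_apply]; rfl
    have : (algebraMap ℚ ℝ) (aeval r p) = 0 := by rw [hcomm, hR]
    exact (map_eq_zero_iff _ (algebraMap ℚ ℝ).injective).mp this
  exact ratRoot_num_den_le H p.natDegree p le_rfl hp0 hcoef hr0 haeval

/-! ### The rational values of the table on the segment, exactly -/

/-- The rational members of the whole table `ALG` in the closed segment, as a set of rationals. [folklore] -/
def algRatSeg : Set ℚ :=
  {v | (81 / 64 : ℚ) ≤ v ∧ v ≤ 2855 / 2048 ∧ ∃ dH ∈ algTable, ((v : ℚ) : ℝ) ∈ algFamily dH.1 dH.2}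

/-- **The rational values of `ALG` on the segment are exactly the fractions `p/q` of the segment with
`p, q ≤ 1024`** (each a degree-1 description; no higher rung — heights `≤ 64` — adds a rational value). [folklore] -/
theorem alg_rational_values_eq :
    algRatSeg = {v : ℚ | (81 / 64 : ℚ) ≤ v ∧ v ≤ 2855 / 2048 ∧ v.num.natAbs ≤ 1024 ∧ v.den ≤ 1024} := by
  ext v
  constructor
  · rintro ⟨h1, h2, dH, hdH, hmem⟩
    have hv0 : v ≠ 0 := by intro h; rw [h] at h1; norm_num at h1
    obtain ⟨hn, hd⟩ := num_den_le_of_ratCast_mem_algFamily hv0 hmem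
    have hH : dH.2 ≤ 1024 := by
      simp only [algTable, List.mem_cons, List.not_mem_nil, or_false] at hdH
      rcases hdH with rfl | rfl | rfl | rfl | rfl | rfl <;> norm_num
    exact ⟨h1, h2, hn.trans hH, hd.trans hH⟩
  · rintro ⟨h1, h2, hn, hd⟩
    have hpos : 0 < v := lt_of_lt_of_le (by norm_num) h1
    have hnum : 1 ≤ v.num := Rat.num_pos.mpr hpos
    refine ⟨h1, h2, (1, 1024), by simp [algTable], ?_⟩
    exact ratCast_mem_algFamily_one hnum (by have := Int.natAbs_of_nonneg (by omega : (0 : ℤ) ≤ v.num); omega) hd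

/-! ### The list of those fractions and its count -/

/-- The naturals `lo, …, hi`. [folklore] -/
def natIcc (lo hi : ℕ) : List ℕ := (List.range (hi + 1 - lo)).map fun i => lo + i

/-- Membership in `natIcc`. [folklore] -/
theorem mem_natIcc {lo hi n : ℕ} : n ∈ natIcc lo hi ↔ lo ≤ n ∧ n ≤ hi := by
  unfold natIcc
  simp only [List.mem_map, List.mem_range]
  constructor
  · rintro ⟨i, hi, rfl⟩; omega
  · intro h; exact ⟨n - lo, by omega, by omega⟩

/-- The numerators for denominator `q`: `p` with `81 q ≤ 64 p`, `2048 p ≤ 2855 q`, `p ≤ 1024`, `gcd(p, q) = 1`. [folklore] -/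
def numsFor (q : ℕ) : List ℕ :=
  (natIcc ((81 * q + 63) / 64) (min 1024 (2855 * q / 2048))).filter fun p => Nat.gcd p q == 1

/-- The fractions of the segment with numerator and denominator `≤ 1024`, denominator by denominator. [folklore] -/
def ratSeg1024 : List ℚ := (natIcc 1 1024).flatMap fun q : ℕ => (numsFor q).map fun p : ℕ => ((p : ℚ) / (q : ℚ))

/-- Kernel: the list has 23 213 entries. [folklore] -/
theorem ratSeg1024_length : ratSeg1024.length = 23213 := by
  decide +kernel

/-- What `numsFor q` lists. [folklore] -/
theorem mem_numsFor {q p : ℕ} (hq : 0 < q) : p ∈ numsFor q ↔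
    (81 : ℚ) / 64 ≤ (p : ℚ) / q ∧ (p : ℚ) / q ≤ 2855 / 2048 ∧ p ≤ 1024 ∧ Nat.Coprime p q := by
  unfold numsFor
  rw [List.mem_filter, mem_natIcc, beq_iff_eq]
  have hq' : (0 : ℚ) < q := by exact_mod_cast hq
  rw [div_le_div_iff₀ (by norm_num) hq', div_le_div_iff₀ hq' (by norm_num)]
  constructor
  · rintro ⟨⟨hlo, hhi⟩, hg⟩
    refine ⟨?_, ?_, ?_, hg⟩
    · have : 81 * q ≤ 64 * p := by omega
      exact_mod_cast (show (81 * q : ℕ) ≤ p * 64 by omega)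
    · have : p ≤ 2855 * q / 2048 := le_trans hhi (min_le_right _ _)
      have : 2048 * p ≤ 2855 * q := by omega
      exact_mod_cast (show (p * 2048 : ℕ) ≤ 2855 * q by omega)
    · exact le_trans hhi (min_le_left _ _)
  · rintro ⟨hlo, hhi, hp, hg⟩
    have hlo' : (81 * q : ℕ) ≤ p * 64 := by exact_mod_cast hlo
    have hhi' : (p * 2048 : ℕ) ≤ 2855 * q := by exact_mod_cast hhi
    refine ⟨⟨by omega, le_min hp (by omega)⟩, hg⟩

/-- Numerator and denominator of a listed fraction. [folklore] -/
theorem num_den_of_mem_numsFor {q p : ℕ} (hq : 0 < q) (hp : p ∈ numsFor q) :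
    ((p : ℚ) / q).num = p ∧ ((p : ℚ) / q).den = q := by
  obtain ⟨-, -, -, hcop⟩ := (mem_numsFor hq).mp hp
  have hq0 : (0 : ℤ) < (q : ℤ) := by exact_mod_cast hq
  have e : ((p : ℚ) / q) = ((p : ℤ) : ℚ) / ((q : ℤ) : ℚ) := by push_cast; rfl
  rw [e]
  exact ⟨Rat.num_div_eq_of_coprime hq0 (by simpa using hcop),
    by exact_mod_cast Rat.den_div_eq_of_coprime hq0 (by simpa using hcop)⟩

/-- What `ratSeg1024` lists: exactly the fractions of `alg_rational_values_eq`. [folklore] -/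
theorem mem_ratSeg1024_iff (v : ℚ) :
    v ∈ ratSeg1024 ↔ (81 / 64 : ℚ) ≤ v ∧ v ≤ 2855 / 2048 ∧ v.num.natAbs ≤ 1024 ∧ v.den ≤ 1024 := by
  constructor
  · intro hv
    obtain ⟨q, hq, hv'⟩ := List.mem_flatMap.mp hv
    obtain ⟨p, hp, hpv⟩ := List.mem_map.mp hv'
    obtain ⟨hq1, hq2⟩ := mem_natIcc.mp hq
    obtain ⟨hlo, hhi, hp1024, -⟩ := (mem_numsFor (by omega)).mp hp
    obtain ⟨hnum, hden⟩ := num_den_of_mem_numsFor (by omega) hp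
    subst hpv
    refine ⟨hlo, hhi, ?_, ?_⟩
    · rw [hnum]; simpa using hp1024
    · rw [hden]; exact hq2
  · rintro ⟨hlo, hhi, hn, hd⟩
    have hpos : 0 < v := lt_of_lt_of_le (by norm_num) hlo
    have hnum : 0 < v.num := Rat.num_pos.mpr hpos
    have e : ((v.num.natAbs : ℕ) : ℚ) / (v.den : ℚ) = v := by
      rw [← Int.cast_natCast, Int.natAbs_of_nonneg hnum.le]
      exact Rat.num_div_den v
    refine List.mem_flatMap.mpr ⟨v.den, mem_natIcc.mpr ⟨v.den_pos, hd⟩, List.mem_map.mpr ⟨v.num.natAbs, ?_, e⟩⟩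
    rw [mem_numsFor v.den_pos, e]
    exact ⟨hlo, hhi, hn, by simpa using v.reduced⟩

/-- `natIcc` has no duplicates. [folklore] -/
theorem natIcc_nodup (lo hi : ℕ) : (natIcc lo hi).Nodup :=
  List.Nodup.map (fun a b h => by simpa using h) List.nodup_range

/-- The list has no duplicates: within a denominator the numerators differ, across denominators the
(reduced) denominators differ. [folklore] -/
theorem ratSeg1024_nodup : ratSeg1024.Nodup := by
  unfold ratSeg1024
  rw [List.nodup_flatMap]
  constructor
  · intro q hq
    obtain ⟨hq1, -⟩ := mem_natIcc.mp hq
    refine List.Nodup.map_on (fun a ha b hb hab => ?_) ((natIcc_nodup _ _).filter _)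
    have h1 := (num_den_of_mem_numsFor (by omega) ha).1
    have h2 := (num_den_of_mem_numsFor (by omega) hb).1
    rw [hab] at h1
    exact_mod_cast h1.symm.trans h2
  · refine (natIcc_nodup 1 1024).pairwise_of_forall_ne fun q₁ hq₁ q₂ hq₂ hne => ?_
    obtain ⟨h1, -⟩ := mem_natIcc.mp hq₁
    obtain ⟨h2, -⟩ := mem_natIcc.mp hq₂
    intro x hx1 hx2
    obtain ⟨a, ha, rfl⟩ := List.mem_map.mp hx1
    obtain ⟨b, hb, hab⟩ := List.mem_map.mp hx2
    have d1 := (num_den_of_mem_numsFor (by omega) ha).2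
    have d2 := (num_den_of_mem_numsFor (by omega) hb).2
    rw [hab] at d2
    exact hne (d1.symm.trans d2)

/-- **`ALG` has exactly 23 213 rational values on the certified segment** — the fractions `p/q` of
`[81/64, 2855/2048]` with `p, q ≤ 1024` (VALUES, i.e. reduced fractions; each is also one degree-1 description,
so the degree-1 description counts 6 657 / 9 090 / 7 468 of the three closed sub-windows are value counts,
`13/10` and `27/20` lying in two sub-windows each). A statement about the catalogue, NOT about `Δε`. [folklore] -/
theorem alg_rational_values_segment_ncard : algRatSeg.ncard = 23213 := by
  rw [alg_rational_values_eq, ← ratSeg1024_length]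
  exact ncard_eq_length_of_iff ratSeg1024_nodup fun v => (mem_ratSeg1024_iff v).symm

/-- The same count on the REAL line: the members of `ALG` in the segment that are rational numbers. [folklore] -/
theorem alg_rational_values_real_ncard :
    {x : ℝ | (81 / 64 : ℝ) ≤ x ∧ x ≤ 2855 / 2048 ∧ (∃ dH ∈ algTable, x ∈ algFamily dH.1 dH.2) ∧
      x ∈ range ((↑) : ℚ → ℝ)}.ncard = 23213 := by
  have c1 : ((81 / 64 : ℚ) : ℝ) = 81 / 64 := by norm_num
  have c2 : ((2855 / 2048 : ℚ) : ℝ) = 2855 / 2048 := by norm_num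
  have e : {x : ℝ | (81 / 64 : ℝ) ≤ x ∧ x ≤ 2855 / 2048 ∧ (∃ dH ∈ algTable, x ∈ algFamily dH.1 dH.2) ∧
      x ∈ range ((↑) : ℚ → ℝ)} = ((↑) : ℚ → ℝ) '' algRatSeg := by
    ext x
    constructor
    · rintro ⟨h1, h2, hmem, v, rfl⟩
      rw [← c1] at h1; rw [← c2] at h2
      exact ⟨v, ⟨Rat.cast_le.mp h1, Rat.cast_le.mp h2, hmem⟩, rfl⟩
    · rintro ⟨v, ⟨h1, h2, hmem⟩, rfl⟩
      exact ⟨by rw [← c1]; exact Rat.cast_le.mpr h1, by rw [← c2]; exact Rat.cast_le.mpr h2, hmem, v, rfl⟩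
  rw [e, Set.ncard_image_of_injective _ Rat.cast_injective, alg_rational_values_segment_ncard]

end ColumnFaceL11
end Summit.CriticalPhenomena.Ising3D
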